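import Literature.AlgebraicGeometry.RealAlgebraic.DividingCurves
import HarnessLib

/-!
# Rokhlin's complex orientations of a dividing plane curve: well-definedness, and the complex
# orientation formula in integrated form (named facts)

Topic `Literature/AlgebraicGeometry/RealAlgebraic`; vocabulary of the companion file
`DividingCurves.lean` (`complexZeroLocus`, `IsDividing`, `IsHalf`, `ovalInterior`,
`complexOrientationSign`). Let `p ∈ ℚ[x, y]` define a NONSINGULAR complex affine curve
`A = {p = 0} ⊆ ℂ²`, GEOMETRICALLY IRREDUCIBLE, with COMPACT real locus `ℝA ⊆ ℝ²` and DIVIDING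
(`IsDividing p`: the non-real locus `A ∖ ℝA` is disconnected). Then (Rokhlin 1974, §2;
Degtyarev–Kharlamov 2000, §1) `A ∖ ℝA` has exactly two connected components ("halves") `H` and
`conj H`, every connected component `O` of `ℝA` (an *oval*: a smooth Jordan curve, since `ℝA` is
a compact nonsingular curve) lies in the closure of both, and the complex orientation of `H`
induces an orientation of `O` — its *complex orientation* — which either agrees or disagrees with
the counter-clockwise orientation of `O` (the boundary orientation of its inside
`ovalInterior O`). In the tree this comparison is the integer `complexOrientationSign p H O`
(`+1` / `-1`; `0` is the junk value "undefined").

Two named facts (D-0014) are recorded here, in exactly the hypotheses of the consuming route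
items (`KontsevichZagierPeriods/ComplexOrientations`, values item `ComplexOrientationIdentity`):

* `complexOrientationSign_isUnit_of_isDividing` — the sign is `±1`, never `0`: complex
  orientations are well defined on every oval of a nonsingular dividing curve (the follow-up named
  in `DividingCurves.lean`, "What is NOT here": local constancy of the pointwise sign along a
  smooth oval, two local half-discs interchanged by `conj`).
* `rokhlin_sum_sign_mul_area_ovalInterior_mem_algebraic_mul_pi` — **Rokhlin's complex
  orientation formula, integrated**: the signed sum of the AREAS of the insides of the ovals,
  `Σ_O complexOrientationSign p H O · Area(ovalInterior O)`, is a real-algebraic multiple of `π`.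
  Mechanism (Rokhlin's `∂H̄ = ℝA` read through Stokes): the real locus with its complex
  orientations bounds the closure `H̄` of the half in the normalisation `Ã` of the projective
  closure; the form `x dy` is holomorphic on the affine curve and meromorphic on `Ã` with poles
  only at the places at infinity `S`, none of which is real because `ℝA` is compact; the residue
  theorem on the compact bordered surface `H̄` (Forster, *Riemann Surfaces*, §10) gives
  `∫_{∂H̄} x dy = 2πi · Σ_{P ∈ S ∩ H̄} Res_P (x dy)`, the residues of the `ℚ`-rational form `x dy`
  at the `ℚ̄`-points `P` are algebraic, and by Green `∮_O x dy = ± Area(ovalInterior O)` with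
  exactly the sign `complexOrientationSign p H O`. Hence the sum equals `2πi Σ Res ∈ (ℚ̄ ∩ ℝ)·π`.
  For the two halves the values are opposite. In print for the area functional:
  Hagg–Shapiro 2026, §5 and Cor. 5.5 with eq. (1.2) (the exterior Cauchy transform of the signed
  planar domain bounded by the complete real locus of a dividing curve, with the complex
  orientation, is an algebraic function; its leading coefficient at `∞` is `Area/π`); the planar
  case (`H` schlicht over a plane domain) is Gustafsson's quadrature identity (1983).

## Scope and design

* Why AREAS and an unnamed algebraic `β`, not the residue identity itself: the tree has no
  vocabulary yet for the places at infinity of the normalisation of a plane curve and residues of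
  `x dy` there (`-- TODO(general form)` below); the recorded corollary is what the consuming
  items use. Why `complexOrientationSign`: it is the tree's rendering of Rokhlin's complex
  orientation of an oval relative to a half (`DividingCurves.lean`, module docstring).
* Every hypothesis matters. Reducible `p` such as `(x² + y² - 1)(x² + y² + 1)` satisfy
  `IsDividing` spuriously (`DividingCurves.lean`, "Scope") and a half of the factor with empty
  real part is adjacent to no oval (sign `0`); a non-compact real component has empty
  `ovalInterior`; singular points can pinch halves. Empty real locus: the sum is empty (and an
  irreducible curve with empty real part is not dividing anyway).
* Consistency in the tree: `Literature.NumberTheory.Transcendental.completePlaneCurvePeriods_zero_or_transcendental`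
  (Huber–Wüstholz, Cor. 13.13) says each `∮_O x dy` is `0` or transcendental — consistent, as
  `βπ` with `β ∈ ℚ̄` is `0` or transcendental. Calibrations: circle `x² + y² = 1` — `Area = π`,
  `Res (x dy) = ∓ i/2` at `[1 : ±i : 0]`, `β = ±1`; for curves of total degree `≤ 2` the second
  fact is PROVED on the Summits side (route `ComplexOrientations`, file
  `…ComplexOrientationIdentityConicsFact`: one ellipse, `Area = 2πρ/√(4ac − b²)`); numerically
  (item evidence of stmt-KontsevichZagierPeriods-11371) the nested dividing quartic
  `(x²+y²−1)(x²+2y²−6) + (x³+x²y+y+1/3)/5` has `Area(in) + Area(out) = π (51/50 + (299/100)√2)`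
  to 15 digits, matching `2πi Σ Res`.

## What is NOT here

* Proofs. The first fact needs the local structure of `A` at a smooth real point (implicit
  function theorem over `ℂ`), Rokhlin's two-halves theorem and the Jordan curve theorem (in the
  tree: `Literature.Topology.PlaneTopology.JordanCurveTheorem_holds`); the second needs in
  addition Green's theorem for smooth Jordan domains and the residue theorem on a compact
  bordered Riemann surface — none in Mathlib or the tree.
* Rokhlin's formula `2(Π⁺ − Π⁻) = l − k²` and the explicit residue value of `β`.

## References

* [Rokhlin1974] V. A. Rokhlin, Complex orientations of real algebraic curves, Funct. Anal. Appl. 8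
  (1974) 331–334, §§2–3.
* [DegtyarevKharlamov2000] A. Degtyarev, V. Kharlamov, Topological properties of real algebraic
  varieties: du côté de chez Rokhlin, Russian Math. Surveys 55 (2000), arXiv:math/0004134, §1.
* [Forster1981] O. Forster, Lectures on Riemann Surfaces, GTM 81, Springer 1981, §§9–10
  (residue theorem).
* [Gustafsson1983] B. Gustafsson, Quadrature identities and the Schottky double, Acta Appl. Math.
  1 (1983) 209–240.
* [HaggShapiro2026] Ch. Hagg, B. Shapiro, Algebraicity of exterior Cauchy transforms of algebraic
  ovals: a homological formulation, arXiv:2606.06296 (2026, preprint), Thm. 4.1, §5, Cor. 5.5,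
  eq. (1.2).
-/

noncomputable section

open MvPolynomial Set
open _root_.MeasureTheory

namespace Literature.AlgebraicGeometry.RealAlgebraic

/-- NAMED FACT — **complex orientations are well defined on a nonsingular dividing curve**
(Rokhlin 1974, §2; Degtyarev–Kharlamov 2000, §1: "the complex orientation of `A±` induces two
opposite orientations on `ℝA`, called its complex orientations"). In the tree's vocabulary: for
`p ∈ ℚ[x,y]` with compact real zero locus, nonsingular complex affine curve, geometrically
irreducible and dividing (`IsDividing p`), for every half `H` (`IsHalf p H`) and every oval `O`
(connected component of the real locus) the sign `complexOrientationSign p H O`, comparing the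
complex orientation of `O` induced from `H` with its counter-clockwise orientation, is `+1` or `-1`
— never the undefined value `0` (locally at a real point the non-real points form two half-discs
interchanged by `conj`, one in `H` and one in `conj H`; `∇p` is transverse to the oval, which is a
smooth Jordan curve with its inside on one side; both pointwise signs are locally constant along
the connected `O`). SCOPE: every hypothesis is used (module docstring, "Scope and design").
Users take `(h : complexOrientationSign_isUnit_of_isDividing)`.
[cite: Rokhlin1974, §2] -/
def complexOrientationSign_isUnit_of_isDividing : Prop :=
  ∀ (p : MvPolynomial (Fin 2) ℚ), IsCompact {v : Fin 2 → ℝ | aeval v p = 0} →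
    (∀ w ∈ complexZeroLocus p, ∃ i, aeval w (pderiv i p) ≠ 0) →
    Irreducible (map (algebraMap ℚ ℂ) p) → IsDividing p →
    ∀ H : Set (Fin 2 → ℂ), IsHalf p H → ∀ v : Fin 2 → ℝ, aeval v p = 0 →
      complexOrientationSign p H (connectedComponentIn {u : Fin 2 → ℝ | aeval u p = 0} v) = 1 ∨
      complexOrientationSign p H (connectedComponentIn {u : Fin 2 → ℝ | aeval u p = 0} v) = -1

/-- NAMED FACT — **Rokhlin's complex orientation formula, integrated** (Rokhlin 1974, §§2–3: the
real locus with its complex orientation is the boundary of a half; with the residue theorem on the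
compact bordered half for the holomorphic form `x dy` — Forster §10 — and Green; in print for the
area functional as Hagg–Shapiro 2026, §5 and Cor. 5.5 with eq. (1.2)). For `p ∈ ℚ[x,y]` with
compact real zero locus, nonsingular complex affine curve, geometrically irreducible and dividing,
and a half `H`: the sum over the ovals `O` (connected components of the real locus) of
`complexOrientationSign p H O · Area(ovalInterior O)` is a real ALGEBRAIC multiple of `π`.
(Value: `∫_{∂H̄} x dy = 2πi Σ_{P ∈ S ∩ H̄} Res_P(x dy)` on the normalisation of the projective
closure, `S` the places at infinity — non-real as the real locus is compact, `ℚ̄`-rational, with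
algebraic residues — and `∮_O x dy = complexOrientationSign p H O · Area(ovalInterior O)` by
Green; opposite values for the two halves; the sum is empty when the real locus is.)
Users take `(h : rokhlin_sum_sign_mul_area_ovalInterior_mem_algebraic_mul_pi)`.
-- TODO(general form): the residue identity itself, once places at infinity of the
-- normalisation and residues of `x dy` there have tree vocabulary.
[cite: Rokhlin1974, §§2–3] -/
def rokhlin_sum_sign_mul_area_ovalInterior_mem_algebraic_mul_pi : Prop :=
  ∀ (p : MvPolynomial (Fin 2) ℚ), IsCompact {v : Fin 2 → ℝ | aeval v p = 0} →
    (∀ w ∈ complexZeroLocus p, ∃ i, aeval w (pderiv i p) ≠ 0) →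
    Irreducible (map (algebraMap ℚ ℂ) p) → IsDividing p →
    ∀ H : Set (Fin 2 → ℂ), IsHalf p H → ∃ β : ℝ, IsAlgebraic ℚ β ∧
      ∑ᶠ O ∈ {O : Set (Fin 2 → ℝ) | ∃ v : Fin 2 → ℝ, aeval v p = 0 ∧
          O = connectedComponentIn {u : Fin 2 → ℝ | aeval u p = 0} v},
        (complexOrientationSign p H O : ℝ) * (volume (ovalInterior O)).toReal = β * Real.pi

/-- The two facts combine into the EXISTENTIAL-sign form used by values statements: unit signs
`η_O := complexOrientationSign p H O` and a real algebraic `β ≥ 0` (after a global sign flip) with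
`Σ_O η_O Area(ovalInterior O) = β π`. [cite: Rokhlin1974, §§2–3] -/
theorem exists_unitSigns_sum_area_ovalInterior_eq_algebraic_mul_pi
    (hsign : complexOrientationSign_isUnit_of_isDividing)
    (hrok : rokhlin_sum_sign_mul_area_ovalInterior_mem_algebraic_mul_pi)
    (p : MvPolynomial (Fin 2) ℚ) (hcpt : IsCompact {v : Fin 2 → ℝ | aeval v p = 0})
    (hsm : ∀ w ∈ complexZeroLocus p, ∃ i, aeval w (pderiv i p) ≠ 0)
    (hirr : Irreducible (map (algebraMap ℚ ℂ) p)) (hdiv : IsDividing p) :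
    ∃ (η : Set (Fin 2 → ℝ) → ℤ) (β : ℝ),
      (∀ v : Fin 2 → ℝ, aeval v p = 0 →
        η (connectedComponentIn {u : Fin 2 → ℝ | aeval u p = 0} v) = 1 ∨
        η (connectedComponentIn {u : Fin 2 → ℝ | aeval u p = 0} v) = -1) ∧
      IsAlgebraic ℚ β ∧ 0 ≤ β ∧
      ∑ᶠ O ∈ {O : Set (Fin 2 → ℝ) | ∃ v : Fin 2 → ℝ, aeval v p = 0 ∧
          O = connectedComponentIn {u : Fin 2 → ℝ | aeval u p = 0} v},
        (η O : ℝ) * (volume (ovalInterior O)).toReal = β * Real.pi := by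
  obtain ⟨H, -, hH, -, -⟩ := isDividing_iff_exists_isHalf_ne.1 hdiv
  obtain ⟨β, hβ, hsum⟩ := hrok p hcpt hsm hirr hdiv H hH
  rcases le_or_gt 0 β with hβ0 | hβ0
  · exact ⟨fun O => complexOrientationSign p H O, β, fun v hv => hsign p hcpt hsm hirr hdiv H hH v hv,
      hβ, hβ0, hsum⟩
  · refine ⟨fun O => -complexOrientationSign p H O, -β, fun v hv => ?_, hβ.neg, by linarith, ?_⟩
    · rcases hsign p hcpt hsm hirr hdiv H hH v hv with h | h <;> simp [h]
    · have key : ∀ O : Set (Fin 2 → ℝ),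
          ((-complexOrientationSign p H O : ℤ) : ℝ) * (volume (ovalInterior O)).toReal =
            -((complexOrientationSign p H O : ℝ) * (volume (ovalInterior O)).toReal) := fun O => by
        rw [Int.cast_neg, neg_mul]
      simp_rw [key, finsum_neg_distrib, hsum, neg_mul]

end Literature.AlgebraicGeometry.RealAlgebraic
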